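import Summits.AtomisticToContinuum.HydrodynamicLimit.Theorems.BoxDissipativeWeakStrongRelativeEnergyStabilityDefs
import Summits.AtomisticToContinuum.HydrodynamicLimit.Theorems.BoxDissipativeWeakStrongRelativeEnergyStabilityCoerciveBoxHelpers
import Literature.Analysis.FluidPDE.HardSphereDynamicsProofs
import Literature.MathematicalPhysics.KineticTheory.HardSphereEulerProofs
import HarnessLib

/-!
# Crux `RelativeEnergyStability` (stmt-AtomisticToContinuum-17653), line `registered`, heart stub S-X —
# helper package C: pairwise distinct velocities along good orbits (`sx_ae_rational_distinct`, `sx_ae_time_distinct`)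

Two registered sub-goals of the heart stub S-X (pathwise layer of the Březina–Feireisl bookkeeping run along
the orbit `s ↦ Φ_s z` of a good datum `z` of the hard-sphere flow `Φ` of `N+1` spheres). The pointwise master
inequality integrated in time by the lead is valid only for configurations whose velocities are pairwise
distinct; for every FIXED time this holds `P_N`-almost surely (`co_ae_distinctVel`), and the two lemmas below
upgrade this to "for `P_N`-a.e. datum, at (almost) every time simultaneously":

* `sx_ae_rational_distinct` — `P_N`-a.e. datum `z` is good (the local Gibbs law is the local Gibbs measure,
  `localGibbsLaw_eq`, which is absolutely continuous w.r.t. Liouville, `localGibbsMeasure_absolutelyContinuous`,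
  and the good set is Liouville-full, `HardSphereFlow.ae_mem_good`) and has pairwise distinct velocities at every
  RATIONAL time (countable intersection, `ae_all_iff`, of the full sets of `co_ae_distinctVel N Φ q`).
* `sx_ae_time_distinct` — along the orbit of such a datum the velocities are pairwise distinct at (almost) every
  time `s`: every time has a collision-free interval `(s, u)` to its right
  (`IsHardSphereTrajectory.exists_Ioo_right_free`), which contains a rational `q` (`exists_rat_btwn`); the orbit is
  free flight on `(s, q]` (field `free` of `IsHardSphereTrajectory`, via `HardSphereFlow.isTrajectory`), and free
  flight does not change velocities (`freeFlight_apply`), so distinctness at `q` transfers to `s`. The statement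
  in fact holds for EVERY `s`; we conclude with `ae_of_all`.

References: BrezinaFeireisl2018 §3.1–3.2 (the bookkeeping these facts serve); GST2013 Prop. 4.1.1 / Def. 4.1.2
(structure of hard-sphere trajectories); measure theory only.
-/

noncomputable section

namespace Summit.AtomisticToContinuum.HydrodynamicLimit.Theorems.RES

open MeasureTheory Filter Set Function
open scoped Topology ENNReal
open Summit.AtomisticToContinuum.HydrodynamicLimit.Theses.BoxDissipativeWeakStrong
open Literature.MathematicalPhysics.KineticTheory Literature.Analysis.FluidPDE

/-- **Velocities stay put on right-free intervals.** Along the orbit of a good datum `z`, for every time `s`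
there is a rational time `q > s` at which every particle has the same velocity as at time `s` (free flight on a
collision-free interval `(s, q]` to the right of `s`). -/
theorem ad_exists_rat_vel_eq {σ : ℝ} {N : ℕ}
    (Φ : HardSphereFlow (Literature.Analysis.FluidPDE.Torus.geometry (Fin 3)) (hsDiameter σ N) (N + 1))
    {z : Config (N + 1) (Fin 3) T3} (hz : z ∈ Φ.good) (s : ℝ) :
    ∃ q : ℚ, s < q ∧ ∀ i, (Φ.flow (q : ℝ) z i).2 = (Φ.flow s z i).2 := by
  have h := Φ.isTrajectory z hz
  obtain ⟨u, hsu, hfree⟩ := h.exists_Ioo_right_free s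
  obtain ⟨q, hsq, hqu⟩ := exists_rat_btwn hsu
  have hflight : Φ.flow (q : ℝ) z =
      freeFlight (Literature.Analysis.FluidPDE.Torus.geometry (Fin 3)) ((q : ℝ) - s) (Φ.flow s z) :=
    h.free s q hsq.le fun τ hτ => hfree τ ⟨hτ.1, hτ.2.trans_lt hqu⟩
  exact ⟨q, hsq, fun i => by rw [hflight, freeFlight_apply]⟩

/-- **Pairwise distinct velocities at every time** (pointwise form of `sx_ae_time_distinct`): if the orbit of a
good datum has pairwise distinct velocities at every rational time, then it has pairwise distinct velocities at
every time. -/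
theorem ad_distinct_of_rational {σ : ℝ} {N : ℕ}
    (Φ : HardSphereFlow (Literature.Analysis.FluidPDE.Torus.geometry (Fin 3)) (hsDiameter σ N) (N + 1))
    {z : Config (N + 1) (Fin 3) T3} (hz : z ∈ Φ.good)
    (hq : ∀ q : ℚ, ∀ i j, i ≠ j → (Φ.flow (q : ℝ) z i).2 ≠ (Φ.flow (q : ℝ) z j).2) (s : ℝ) :
    ∀ i j, i ≠ j → (Φ.flow s z i).2 ≠ (Φ.flow s z j).2 := by
  obtain ⟨q, -, hvel⟩ := ad_exists_rat_vel_eq Φ hz s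
  intro i j hij
  rw [← hvel i, ← hvel j]
  exact hq q i j hij

/-- **(C1) Good data whose orbit has pairwise distinct velocities at every rational time form a `P_N`-full
set**: the local Gibbs law is absolutely continuous w.r.t. the Liouville measure, for which the good set is full,
and for each of the countably many rational times the distinct-velocity event is `P_N`-full
(`co_ae_distinctVel`). -/
theorem sx_ae_rational_distinct {σ : ℝ} {a₀ θ₀ : T3 → ℝ} {u₀ : T3 → V3} (N : ℕ)
    (Φ : HardSphereFlow (Literature.Analysis.FluidPDE.Torus.geometry (Fin 3)) (hsDiameter σ N) (N + 1)) :
    ∀ᵐ z ∂(localGibbsLaw σ a₀ u₀ θ₀ N Φ), z ∈ Φ.good ∧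
      ∀ q : ℚ, ∀ i j, i ≠ j → (Φ.flow (q : ℝ) z i).2 ≠ (Φ.flow (q : ℝ) z j).2 := by
  have hgood : ∀ᵐ z ∂(localGibbsLaw σ a₀ u₀ θ₀ N Φ), z ∈ Φ.good := by
    rw [localGibbsLaw_eq]
    exact Φ.ae_mem_good.filter_mono (localGibbsMeasure_absolutelyContinuous σ a₀ u₀ θ₀ N Φ).ae_le
  have hrat : ∀ᵐ z ∂(localGibbsLaw σ a₀ u₀ θ₀ N Φ),
      ∀ q : ℚ, ∀ i j, i ≠ j → (Φ.flow (q : ℝ) z i).2 ≠ (Φ.flow (q : ℝ) z j).2 :=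
    ae_all_iff.2 fun q => co_ae_distinctVel N Φ (q : ℝ)
  exact hgood.and hrat

/-- **(C2) Along such an orbit, the velocities are pairwise distinct at almost every time** (in fact at every
time, `ad_distinct_of_rational`: velocities are piecewise constant and right-continuous in time, so their values
at any time are attained at a slightly later rational time). -/
theorem sx_ae_time_distinct {σ : ℝ} {N : ℕ}
    (Φ : HardSphereFlow (Literature.Analysis.FluidPDE.Torus.geometry (Fin 3)) (hsDiameter σ N) (N + 1))
    {z : Config (N + 1) (Fin 3) T3} (hz : z ∈ Φ.good)
    (hq : ∀ q : ℚ, ∀ i j, i ≠ j → (Φ.flow (q : ℝ) z i).2 ≠ (Φ.flow (q : ℝ) z j).2) :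
    ∀ᵐ s ∂(volume : Measure ℝ), ∀ i j, i ≠ j → (Φ.flow s z i).2 ≠ (Φ.flow s z j).2 :=
  ae_of_all _ (ad_distinct_of_rational Φ hz hq)

end Summit.AtomisticToContinuum.HydrodynamicLimit.Theorems.RES

end
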